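import Summits.QuantumFields.BalabanUV.T4Continuum.Support.SpreadLift
import HarnessLib

/-!
# T⁴ programme, node NE3 — row E-RES♯, sub-row (R♯3a) «DRESSED SLICE LIFT — PUSH DEFECT»: the literal END, BY NAME over the
# spread lift of sub-row S6-Y7 (c)

NE3 (node U1b) formalisation swarm `b2b-balaban-t4-ne3-formalise-*`, leaf seat `b2b-balaban-t4-ne3-formalise-leaf-01`
(gen 4), row **E-RES♯ (R♯3a)** of the owner's cut (journal `HOME/CLAIMS.log` l.14429; CLAIM l.14464; FINDING F-ne3leaf01g4-1).

WHY.  The owner's (RES♯) plan needs a DRESSED lift of a coarse direction `φ` to the fine lattice — the coarse value transported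
along the block tree to the slice bond — whose push-forward under the linearised average `pushDir L V` of (42) returns `φ` up to
`O(a)·‖φ‖` at a unitary small-field background `V`.  That lift EXISTS IN THE TREE: it is `SpreadLiftDirection.spreadLift L V φ`
(this lineage, gen 3, sub-row S6-Y7 (c): the datum transported from the corner of the block ENTERED by each crossing bond along
its tree contour to the bond's end point — the frame forced by the tree's conventions `gaugeAct`∕`dirGauge`∕`dhol`∕`pushDir`), its
push-forward is `spreadMap` bondwise (`SpreadLiftDirection.pushDir_spreadLift`) and `spreadMap = id + O(d·L²·a)`
(`SpreadLiftMap.norm_spreadMap_sub_le`).  THIS FILE (0 `def`, 0 `sorry`) records the row's literal END as the two-line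
composition, under the cell's standard smallness only:

* **`norm_pushDir_spreadLift_sub_le`** — `1 ≤ L`, unitary `V`, `SmallField V a`, `0 ≤ a`, `512(d+1)(d+4)L²a ≤ 1`:
  `‖pushDir L V (spreadLift L V φ) (L•y) κ − φ y κ‖ ≤ 64·d·L²·a·‖φ y κ‖` at EVERY coarse bond (`C₁(d, L) = 64·d·L²`);
* `norm_pushDir_spreadLift_le` — hence `‖pushDir L V (spreadLift L V φ) (L•y) κ‖ ≤ (1 + 64·d·L²·a)·‖φ y κ‖`;
* (pointer, no lemma): the EXACT right inverse is `SpreadLift.pushDir_spreadInverse` — sub-row (R♯4)'s exactness needs no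
  defect correction.

HONEST FRAMING.  Kinematics of ONE averaging operator at ONE background (our frame; [folklore]); nothing about Bałaban's
minimisers; (RES♯) NOT proved (its curl estimate (R♯3b) and assembly (R♯5) remain); **NE3 is NOT proved**; spine PROVED 0∕9;
finite T⁴ rung (B)+1 — NOT infinite volume, NOT mass gap, NOT `BetaPertH`, NOT Clay.  PLACEMENT: `Summits/QuantumFields/BalabanUV/`;
imports `Support.SpreadLift` (p216492) only; restates nothing.  HONEST DEPENDENCY (cell page 1): continuum YM on T⁴ ⇐ BetaPertH ∧
nine spine estimates (0/9 proved); BetaPertH ⇐ (D1) ∧ (D4) ∧ CAP+tail; G-an2-4 gates asym, D1 and NE2/3/4.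
-/

set_option autoImplicit false

open scoped BigOperators Matrix Matrix.Norms.L2Operator

namespace Summit.QuantumFields.BalabanUV.T4Continuum.NE3SpreadLiftPushDefect

open Literature.MathematicalPhysics.QuantumFieldTheory.Balaban1983to89
open B7Prop1Explicit B7Prop2Explicit
open T4AveragingDeficitWall hiding Site Plane Plaq Bond
open AveragingDeficitResidualPairing (pushDir)
open SpreadLiftDirection (spreadLift pushDir_spreadLift)
open SpreadLiftMap (norm_spreadMap_sub_le)
open SpreadLift (loopRad_le loopBound_of_smallField)

noncomputable section

variable {d : ℕ} {n : Type*} [Fintype n] [DecidableEq n] [Nonempty n]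

/-- **(R♯3a) THE PUSH DEFECT OF THE DRESSED (SPREAD) LIFT**: for `L ≥ 1`, unitary `V` in `SmallField V a` with the standard
smallness `512(d+1)(d+4)L²a ≤ 1`, every coarse direction `φ` and every coarse bond `c = (y, κ)`:
`‖pushDir L V (spreadLift L V φ) (L•y) κ − φ y κ‖ ≤ 64·d·L²·a·‖φ y κ‖`. [folklore] -/
theorem norm_pushDir_spreadLift_sub_le {L : ℕ} (hL : 1 ≤ L) {V : Site d → Fin d → (Matrix n n ℂ)ˣ} (hV : IsUnitaryCfg V)
    {a : ℝ} (ha : 0 ≤ a) (h512 : 512 * (d + 1) * (d + 4) * (L : ℝ) ^ 2 * a ≤ 1) (hVa : SmallField V a)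
    (φ : Site d → Fin d → Matrix n n ℂ) (y : Site d) (κ : Fin d) :
    ‖pushDir L V (spreadLift L V φ) ((L : ℤ) • y) κ - φ y κ‖ ≤ 64 * (d * (L : ℝ) ^ 2 * a) * ‖φ y κ‖ := by
  rw [pushDir_spreadLift hL V y κ (loopRad_le h512) (loopBound_of_smallField hL hV ha h512 hVa y κ)]
  exact norm_spreadMap_sub_le hL hV ha hVa y κ _ _ (φ y κ)

/-- … hence `‖pushDir L V (spreadLift L V φ) (L•y) κ‖ ≤ (1 + 64·d·L²·a)·‖φ y κ‖`. [folklore] -/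
theorem norm_pushDir_spreadLift_le {L : ℕ} (hL : 1 ≤ L) {V : Site d → Fin d → (Matrix n n ℂ)ˣ} (hV : IsUnitaryCfg V)
    {a : ℝ} (ha : 0 ≤ a) (h512 : 512 * (d + 1) * (d + 4) * (L : ℝ) ^ 2 * a ≤ 1) (hVa : SmallField V a)
    (φ : Site d → Fin d → Matrix n n ℂ) (y : Site d) (κ : Fin d) :
    ‖pushDir L V (spreadLift L V φ) ((L : ℤ) • y) κ‖ ≤ (1 + 64 * (d * (L : ℝ) ^ 2 * a)) * ‖φ y κ‖ := by
  have h := norm_pushDir_spreadLift_sub_le hL hV ha h512 hVa φ y κ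
  have htri : ‖pushDir L V (spreadLift L V φ) ((L : ℤ) • y) κ‖
      ≤ ‖pushDir L V (spreadLift L V φ) ((L : ℤ) • y) κ - φ y κ‖ + ‖φ y κ‖ := by
    have := norm_add_le (pushDir L V (spreadLift L V φ) ((L : ℤ) • y) κ - φ y κ) (φ y κ)
    rwa [sub_add_cancel] at this
  linarith

end

end Summit.QuantumFields.BalabanUV.T4Continuum.NE3SpreadLiftPushDefect
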